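import Literature.Computability.Cryptography.CubicClassTable
import Mathlib.NumberTheory.NumberField.ClassNumber
import Mathlib.NumberTheory.NumberField.Units.Regulator
import HarnessLib

/-!
# The class-group table, ladder-walk form, and its parametric structural interface (definitions)

Topic `Computability/Cryptography`; DEFINITIONS ONLY, third companion of `CubicClassTable.lean` (crux
`LinnikCubicClassGroups.PureCubicClassGroupFBQP`, line `arakelov-giant-step-cycle`). The semantics part of the line found
that the power walk of `classTableOpP` (square-and-multiply of the filtered step `h⋆` to the exponent
`n = ⌊(Δ − margin)/o⋆⌋`) does NOT land near `Δ − margin`: a clamped squaring `starCc x x` doubles the position TOGETHER with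
all reduction defects accumulated so far (`2·x.2 + ô`), so `h⋆^n` sits at `n·o⋆ + Σ_i w_i ô_i` with weights
`w_i = 2^{#later squarings}` (`Σ w_i = n − 1`), i.e. anywhere in a window of width `≈ n · 2^prec log|d_K| ≫ margin`
(`n` is as large as `≈ 21 R_K`), after which polynomially many guarded baby steps cannot reach `t⋆`. This file defines the
repaired walk — the Buchmann–Williams LADDER with linear error growth — and the interface the semantics part proves for it:

* `Inst.KInt` — the per-product defect bound `2^prec (10 size(ab) + 48)`;
* `stepc`, `hbase` — `s₀` unguarded clamped baby steps from `𝓞_K`: the ladder base `h`, a reduced principal ideal at computed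
  position `p₀ ∈ 2^prec·[2 KN, 1.8 KN²]` (`KN = 10 size(ab) + 48`, six-gap lemma);
* `ladder i` — `g_i = h^(2^i)` by `i` clamped squarings; only their COMPUTED positions `p_{i+1} = 2 p_i + ô_i`
  (`2^(i−1) p₀ ≤ p_i ≤ (5/2)^i p₀`) are used, so their own (doubled) defects are harmless;
* `tryMul`, `descend` — the greedy descent from `b_e` towards `X = t⋆ − margin`: levels `Tdbl − 1, …, 0`, at each level up to
  three multiplications `st ↦ st ⋆ g_i` guarded by `st.2 + p_i + KInt ≤ X` (residual `< (5/2) p_i + KInt` entering level `i`,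
  `< p_i + KInt` leaving it), hence a reduced ideal of the class at computed position in `(X − p₀ − KInt, X]` after
  `≤ 3 (6 LD + 2)` products;
* `c0q`, `cfinq`, `classTableOpQ` — then `Bb` clamped guarded baby steps towards `t⋆` and the cell index, as before;
* `ClassTableInterfaceQE` — the structural interface of `classTableOpQ` with an extra precision parameter `e`: off a coin set
  of density `2^-(40+e)` and a defect set of density `2^-(30+e)` the table is the shift-cell table `C_{cls E}((σ E + j) mod 2^s)`
  (classes = cosets of the relation lattice, exact-affine shifts up to rounding, run-shaped cells); hypotheses: `m = ab²`,
  `ℓe` inside the advice-precision inequality (the exponent-weighted `±1` roundings of `b_e`), `s₀ = 18 KN`, `Tdbl ≥ 6 LD + 10`,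
  `margin = 0`, `Bb ≥ 16 KN²`, `cap ≥ (243a²b²)²`, `|ps| ≤ 2^32`, `ℓb = 24 (size cap + 2)(50 + e)`.
[Hallgren 2005, §4; Buchmann–Williams 1988, §3]

## References

* S. Hallgren, STOC 2005, §4. [Hallgren2005]
* J. Buchmann, H. C. Williams, Math. Comp. 50 (1988), §3. [BuchmannWilliams1988]
-/

noncomputable section

namespace Literature.Computability.Cryptography

namespace CubicClassTable

namespace Inst

/-- The per-product defect bound `KInt = 2^prec (10 size(ab) + 48)` (the same constant as in `WalkFns.O`). [folklore] -/
def KInt (I : Inst) : ℤ := ((2 ^ I.prec * (10 * Nat.size (I.a * I.b) + 48) : ℕ) : ℤ)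

end Inst

namespace WalkFns

variable (F : WalkFns) (I : Inst)

/-- One unguarded clamped baby step with the position added. [cite: BuchmannWilliams1988, §3] -/
def stepc (cap : ℕ) (st : PLat) : PLat := ((F.redc I cap st.1).1, st.2 + (F.redc I cap st.1).2)

/-- The ladder base `h`: `s₀` baby steps from `𝓞_K` (a reduced principal ideal at computed position
`p₀ ≥ 2^prec ⌊s₀/6⌋ log 2 − s₀`). [cite: BuchmannWilliams1988, §3] -/
def hbase (cap : ℕ) : PLat := (F.stepc I cap)^[I.s₀] (I.ord, 0)

/-- The ladder `g_i`: `i` clamped squarings of `h` (reduced principal ideals with computed positions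
`p_{i+1} = 2 p_i + ô_i`). [cite: BuchmannWilliams1988, §3] -/
def ladder (cap i : ℕ) : PLat := (fun x => F.starCc I cap x x)^[i] (F.hbase I cap)

/-- One guarded multiplication by `g_i` towards the target `X`: fire only if the new position is certainly `≤ X`.
[cite: BuchmannWilliams1988, §3] -/
def tryMul (cap : ℕ) (X : ℤ) (i : ℕ) (st : PLat) : PLat :=
  if st.2 + (F.ladder I cap i).2 + I.KInt ≤ X then F.starCc I cap st (F.ladder I cap i) else st

/-- The greedy descent: levels `Tdbl − 1, …, 0`, three guarded multiplications each. [cite: BuchmannWilliams1988, §3] -/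
def descend (cap : ℕ) (X : ℤ) (st : PLat) : PLat :=
  ((List.range I.Tdbl).reverse).foldl (fun acc i => (F.tryMul I cap X i)^[3] acc) st

/-- The state after the descent from `b_e` towards `t⋆ − margin`. [cite: Hallgren2005, §4] -/
def c0q (cap : ℕ) (v : ℕ) : PLat := F.descend I cap (F.tstarc I cap v - I.margin) (F.bEc I cap v)

/-- The final state of the ladder walk: `Bb` clamped guarded baby steps towards `t⋆`. [folklore] -/
def cfinq (cap : ℕ) (v : ℕ) : PLat := (F.babyStepc I cap v)^[I.Bb] (F.c0q I cap v)

/-- **The class-group table, ladder-walk form**: the code of the ideal reached and the cell index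
`(t⋆ − pos)/2^{prec − n''}`. [cite: Hallgren2005, §4] -/
def classTableOpQ (cap : ℕ) (v : ℕ) : Lat × ℕ :=
  ((F.cfinq I cap v).1, (F.tstarc I cap v - (F.cfinq I cap v).2).toNat / 2 ^ (I.prec - I.npp))

end WalkFns

open scoped NumberField nonZeroDivisors

/-- **The parametric structural interface of the ladder-walk class table** `classTableOpQ`: for admissible data and
adequate parameters (extra precision `e`), the hidden lattice `Λ ≤ ℤ^T` (`T = 3|ps|`) has index the order of the subgroup of
`Cl(𝓞_K)` generated by the degree-one primes above `ps`; off a set of coin values of density `2^-(40+e)` the table ignores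
the coins; off a defect set of density `2^-(30+e)` it is the shift-cell table `C_{cls E}((σ E + j) mod 2^s)` of classes =
cosets of `Λ` through the digit vectors, with class-disjoint cell values, exact-affine shifts up to rounding (`y`, `μ`), and
run-shaped cells, few per class. [cite: Hallgren2005, §4] -/
def ClassTableInterfaceQE (F : CubicClassTable.WalkFns) (a b : ℕ) (K : Type*) [Field K] [NumberField K]
    (ord : ℕ × List ℤ) : Prop :=
  ∀ (m : ℕ) (ps : List ℕ) (r k : ℕ), (∀ p ∈ ps, p.Prime ∧ ¬ p ∣ 3 * m) → m = a * b ^ 2 →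
      |(r : ℝ) - 2 ^ k * NumberField.Units.regulator K| ≤ 1 →
      ∀ (ℓe npp ℓy ℓκ ℓb prec s s₀ Tdbl Bfin Bb margin cap e : ℕ),
        20 ≤ ℓe → ps.length ≤ 2 ^ 32 →
        ℓe + s + npp + 60 + 6 * Nat.size (27 * a ^ 2 * b ^ 2) + e ≤ k → k + s + npp + 64 ≤ prec →
        npp + 6 * Nat.size (27 * a ^ 2 * b ^ 2) + 50 + e ≤ s → s ≤ ℓy →
        s₀ = 18 * (10 * Nat.size (a * b) + 48) → 6 * Nat.size (27 * a ^ 2 * b ^ 2) + 10 ≤ Tdbl → margin = 0 →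
        16 * (10 * Nat.size (a * b) + 48) ^ 2 ≤ Bb →
        (243 * a ^ 2 * b ^ 2) ^ 2 ≤ cap → (∀ p ∈ ps, (243 * a ^ 2 * b ^ 2 * (p + 1)) ^ 2 ≤ cap) →
        ℓb = 24 * (Nat.size cap + 2) * (50 + e) → ps.length * ℓb ≤ ℓκ →
        ∃ (Λ : AddSubgroup (Fin (3 * ps.length) → ℤ)) (_ : Λ.FiniteIndex)
          (F₀ : ℕ → (ℕ × List ℤ) × ℕ) (cls σ : ℕ → ℕ) (C : ℕ → ℕ → (ℕ × List ℤ) × ℕ) (y : ℕ → ℝ)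
          (μ : Fin (3 * ps.length) → ℝ) (Badκ D : Finset ℕ),
          Λ.index = Nat.card (Subgroup.closure {c : ClassGroup (𝓞 K) | ∃ p ∈ ps, ∃ P : Ideal (𝓞 K),
            ∃ hP : P ∈ nonZeroDivisors (Ideal (𝓞 K)), c = ClassGroup.mk0 ⟨P, hP⟩ ∧ P.IsPrime ∧ Ideal.absNorm P = p}) ∧
          (Badκ.card : ℝ) ≤ (1 / 2) ^ (40 + e) * 2 ^ ℓκ ∧
          (∀ v : ℕ, (v / ((2 ^ ℓe) ^ (3 * ps.length) * 2 ^ ℓy)) % 2 ^ ℓκ ∉ Badκ →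
            F.classTableOpQ ⟨a, b, m, ps, ord, r, k, prec, s, ℓe, npp, ℓy, ℓκ, ℓb, s₀, Tdbl, Bfin, Bb, margin⟩ cap v =
              F₀ (v % ((2 ^ ℓe) ^ (3 * ps.length) * 2 ^ ℓy))) ∧
          (D.card : ℝ) ≤ (1 / 2) ^ (30 + e) * ((2 ^ ℓe) ^ (3 * ps.length) * 2 ^ ℓy : ℕ) ∧
          (∀ E < (2 ^ ℓe) ^ (3 * ps.length), ∀ j < 2 ^ ℓy, E + (2 ^ ℓe) ^ (3 * ps.length) * j ∉ D →
            F₀ (E + (2 ^ ℓe) ^ (3 * ps.length) * j) = C (cls E) ((σ E + j) % 2 ^ s)) ∧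
          (∀ E < (2 ^ ℓe) ^ (3 * ps.length), ∀ E' < (2 ^ ℓe) ^ (3 * ps.length), cls E = cls E' ↔
            (fun t : Fin (3 * ps.length) => ((E / (2 ^ ℓe) ^ (t : ℕ) % 2 ^ ℓe : ℕ) : ℤ) -
              ((E' / (2 ^ ℓe) ^ (t : ℕ) % 2 ^ ℓe : ℕ) : ℤ)) ∈ Λ) ∧
          (∀ E < (2 ^ ℓe) ^ (3 * ps.length), ∀ E' < (2 ^ ℓe) ^ (3 * ps.length), ∀ i < 2 ^ s, ∀ i' < 2 ^ s,
            C (cls E) i = C (cls E') i' → cls E = cls E') ∧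
          (∀ E < (2 ^ ℓe) ^ (3 * ps.length), |(σ E : ℝ) - y E| ≤ 1) ∧
          (∀ E < (2 ^ ℓe) ^ (3 * ps.length), ∀ E' < (2 ^ ℓe) ^ (3 * ps.length), cls E = cls E' →
            ∃ z : ℤ, y E' - y E + 2 ^ s * ∑ t : Fin (3 * ps.length), μ t *
              (((E' / (2 ^ ℓe) ^ (t : ℕ) % 2 ^ ℓe : ℕ) : ℝ) - ((E / (2 ^ ℓe) ^ (t : ℕ) % 2 ^ ℓe : ℕ) : ℝ)) = 2 ^ s * z) ∧
          (∀ E < (2 ^ ℓe) ^ (3 * ps.length),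
            (∀ ω ∈ (Finset.range (2 ^ s)).image (C (cls E)), ∃ b₁ b₂ b₁' b₂' : ℕ,
              Disjoint (Finset.Ico b₁ b₂) (Finset.Ico b₁' b₂') ∧
              (Finset.range (2 ^ s)).filter (fun i => C (cls E) i = ω) = Finset.Ico b₁ b₂ ∪ Finset.Ico b₁' b₂') ∧
            ((Finset.range (2 ^ s)).image (C (cls E))).card ≤ 2 ^ (npp + 2) * (27 * a ^ 2 * b ^ 2) ^ 6 + 2 ^ 10)

end CubicClassTable

end Literature.Computability.Cryptography
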